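import Literature.AnabelianGeometry.EtaleTheta.Discharge.Sec2AutKDottedOfOdd
import Literature.AnabelianGeometry.EtaleTheta.Discharge.Sec2Cor29ModelKrullNormalizer
import Literature.AnabelianGeometry.EtaleTheta.Discharge.Sec2Prop26FalseAtModelKrull
import HarnessLib

/-!
# [EtTh] Cor. 2.9 (all six members) and Rmk. 2.6.1 (dotted) AT THE §1 MODELS with NO Prop. 2.6: the setting-born
# cover, and the census of record at the cusped untwisted Krull model `κ′` — where Prop. 2.6 AS TYPED is FALSE
# and the six-member count nevertheless HOLDS (proof-only)

S. Mochizuki, *The étale theta function and its Frobenioid-theoretic manifestations*, Publ. RIMS **45** (2009) [EtTh],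
§2: Rmk. 2.6.1 p. 40, Prop. 2.6 p. 40, Cor. 2.9 p. 43 («for each of `Ẋ̲̲, Ċ̲, Ċ̲̲, X̲̲, C̲, C̲̲` … `(ℤ/lℤ)^±`»)
[cite: MochizukiEtTh2009, Cor 2.9 p.43]. Cell abc-iut, layer L2, seat abc-iut-L2-t12 (gen 9), L2-lead row (w2)
«COR29-SIX-COUNT@κ′/χ′ WITHOUT PROP26» (R848/R898), file 2/2. PROOF-ONLY (no definition, no instance, no `Prop` fact).
Inputs BY NAME: file 1/2 `Sec2AutKDottedOfOdd` (`cor29_card_of_odd`, `rmk261_dotted_of_odd`: abc-iut-L2-d3's closers with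
the Prop. 2.6 (F-0610) and temp-slimness binders DELETED), abc-iut-L2-d3's model assembly `CLevelData.temperedCoverData`
and its discharges `temperedCoverData_hTheta` / `_hC1` / `_hC2_of_normalizes` / `_hasMuL` / `_toCoverDataAx` /
`rmk261_ofSetting`, abc-iut-L2-t10's Krull rows K8/K10 (`Sec2Cor29ModelKrull*`: `hfix_inversionModelκ'`,
`conj_commutator_mem_lDeltaTheta_inversionModelκ'`, `cuspLaws_modelκ'`, `decompCommensurablyTerminal_curveκ'`,
`kerToZIsCompactlyGenerated_modelκ'`, the κ′ `piCDataOf` bundle), abc-iut-f-151's `not_prop26_temperedCoverData_inversionModelκ'`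
(`Sec2Prop26FalseAtModelKrull`, p475371). Nothing restated.

* §1 (any `MuTwoSetting`, abc-iut-L2-d3's setting-born cover `e.temperedCoverData …`): `temperedCoverData_rmk261_dotted_of_odd`
  (Rmk. 2.6.1 dotted, NO binder beyond the assembly's own), `temperedCoverData_cor29_card_of_odd` (Cor. 2.9, all six members,
  residual = {compact `D_x`, [SemiAnbd] Thm. 6.5 (ii) `DecompCommensurablyTerminal` (F-1658), the normaliser witness `hfix`} —
  abc-iut-L2-d3's `temperedCoverData_cor29_card` WITHOUT `hslim` and WITHOUT `h26`), and the end-to-end ∃-form from the cusp laws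
  `exists_temperedCoverData_hasMuL_cor29_card_of_cuspLaws_of_normalizer_of_odd` (abc-iut-L2-t10's K10 v2 with `T.Prop26 →` GONE).
* §2 (**the census of record at `κ′`, answering the row**): for every odd `l` (`≠ 1` for the Rmk. 2.6.1 clauses) and every
  once-punctured bundle `eX` of `modelκ′`, THE cusp-law cover `T` on the `Π^tp_C` of `inversionModelκ′` (K8's datum: profinite part
  = the DERIVED `coverDataAx` on `PiCκ p`) satisfies `T.HasMuL`, **`T.Cor29_card` OUTRIGHT**, `T.Rmk261_dotted` OUTRIGHT, the
  unpacked six-member count «each of `Ẋ̲̲, Ċ̲, Ċ̲̲, X̲̲, C̲, C̲̲` has `(l+1)/2` `Aut_K`-orbits of cusps» — **AND `¬ T.Prop26`**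
  (abc-iut-f-151) at the SAME `T` (`exists_temperedCoverData_cor29_not_prop26_inversionModelκ'`): the conclusions that K8/K10/K11
  could only state as «`T.Prop26 → …`» — vacuous at `κ′` — hold there unconditionally. HONEST COUNT: print's SIX members, each with
  `(l+1)/2` orbits, at `κ′`; not fewer. (`χ′`: no cusp-law `TemperedCoverData` datum of `inversionModelχ′` is in the tree at this
  writing, so the row's `χ′` half is not instantiated here; the generic §1 applies verbatim once one is assembled.)

HONEST FRAMING: SEMI-SYNTHETIC model (untwisted Galois action; `Π^tp_C` of the MODEL, not of an orbicurve) — consistency /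
non-vacuity evidence for the typed §2 interface ONLY; the typed `HasMuL` is weaker than print's «`μ_l ⊆ K`» at this carrier (abc-iut-L2-t10
K10 v2); refuted-at-a-model (`¬ T.Prop26`) ≠ refuted-in-print; nothing of [EtTh]/[SemiAnbd] is asserted or denied for genuine tempered
fundamental groups; no side is taken on [IUTchIII] Cor. 3.12; typed ≠ proved; instantiated ≠ endorsed.
-/

noncomputable section

namespace Literature.AnabelianGeometry.EtaleTheta

open Literature.AnabelianGeometry.SemiGraphs ThetaCovers
open _root_.Topology

/-! ## §1. The setting-born cover: Rmk. 2.6.1 (dotted) and Cor. 2.9 with no Prop. 2.6 and no slimness -/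

namespace MuTwoSetting.CLevelData

variable {p : ℕ} [Fact p.Prime] {M : MuTwoSetting p}
variable {PC : Type} [Group PC] [TopologicalSpace PC] [IsTopologicalGroup PC] [T2Space PC]

section Binders

variable (e : M.CLevelData) (ιC : M.GtpC →ₜ* PC)
    (hιC : IsProfiniteCompletion ιC) (hinj : Function.Injective ιC) (op : M.toThetaSetting.OncePuncturedData)
    {l : ℕ} (hodd : Odd l) {x : M.Pt} (hx : M.IsCusp x)
    (hIx : ((e.piCDataOf ιC hιC).Dx x ⊓ (e.piCDataOf ιC hιC).augGK.ker) ⊔ (e.piCDataOf ιC hιC).barKer l =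
      (e.piCDataOf ιC hιC).barTheta l)
    (hιell : ∀ c ∈ (e.piCDataOf ιC hιC).augGK.ker, c ∉ (e.piCDataOf ιC hιC).PiX →
      ∀ d ∈ (e.piCDataOf ιC hιC).PiX ⊓ (e.piCDataOf ιC hιC).augGK.ker,
        c * d * c⁻¹ * d ∈ (e.piCDataOf ιC hιC).barTheta l)
    (hN : ((M.GtpXu l).map M.inclX).Normal) (hY : (M.GtpY.map M.inclX).Normal) {S : Subgroup PC}
    (hS : ((e.piCDataOf ιC hιC).coverDataAx l op hx hodd hIx hιell
        ((e.piCDataOf ιC hιC).inv_theta_of_inv_ell l op hιell)).toCoverData.IsSplitting S)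
    (hSc : IsClosed (S : Set PC))

/-- **[EtTh] Rmk. 2.6.1 for the once-dotted curves at the setting-born cover, NO extra binder**: abc-iut-L2-t2's
`T.Rmk261_dotted` for `e.temperedCoverData …`, by `rmk261_dotted_of_odd` fed with `temperedCoverData_hTheta` (abc-iut-L2-d3's
`rmk261_dotted_ofSetting` needed `T.Prop26` and slimness). [cite: MochizukiEtTh2009, Rmk 2.6.1 p.40] -/
theorem temperedCoverData_rmk261_dotted_of_odd [NeZero l] :
    (e.temperedCoverData ιC hιC hinj op hodd hx hIx hιell hN hY hS hSc).Rmk261_dotted :=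
  (e.temperedCoverData ιC hιC hinj op hodd hx hIx hιell hN hY hS hSc).rmk261_dotted_of_odd
    (temperedCoverData_hTheta e ιC hιC hinj op hodd hx hIx hιell hN hY hS hSc)

/-- **[EtTh] Cor. 2.9 (all six members) at the setting-born cover WITHOUT Prop. 2.6 and WITHOUT slimness**: abc-iut-L2-t2's
`T.Cor29_card` for `e.temperedCoverData …`; residual inputs BY NAME: compact `D_x`, [SemiAnbd] Thm. 6.5 (ii)
(`DecompCommensurablyTerminal`, F-1658), the normaliser witness `hfix` (an element of `Π^tp_C ∖ Π^tp_X` normalising `inclX(D_x)`) —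
abc-iut-L2-d3's `temperedCoverData_cor29_card` with `hslim` and `h26` DELETED. [cite: MochizukiEtTh2009, Cor 2.9 p.43] -/
theorem temperedCoverData_cor29_card_of_odd (hDc : IsCompact (M.decomp x : Set M.PiTemp))
    (h65 : M.toTemperedCurve.DecompCommensurablyTerminal)
    (hfix : ∃ g : M.GtpC, g ∉ M.inclX.range ∧
      g ∈ Subgroup.normalizer (((M.decomp x).map M.inclX : Subgroup M.GtpC) : Set M.GtpC)) :
    (e.temperedCoverData ιC hιC hinj op hodd hx hIx hιell hN hY hS hSc).Cor29_card :=
  (e.temperedCoverData ιC hιC hinj op hodd hx hIx hιell hN hY hS hSc).cor29_card_of_odd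
    (temperedCoverData_hTheta e ιC hιC hinj op hodd hx hIx hιell hN hY hS hSc)
    (temperedCoverData_hC1 e ιC hιC hinj op hodd hx hIx hιell hN hY hS hSc hDc h65)
    (temperedCoverData_hC2_of_normalizes e ιC hιC hinj op hodd hx hIx hιell hN hY hS hSc hDc hfix)

end Binders

/-- **Cor. 2.9 for SOME assembled cover from the cusp laws, `HasMuL` included, NO Prop. 2.6, NO slimness** — abc-iut-L2-t10's K10 v2
`exists_temperedCoverData_hasMuL_cor29_card_of_cuspLaws_of_normalizer` with the conclusion `T.Prop26 → T.Cor29_card` REPLACED by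
`T.Cor29_card` and the binder `hslim` GONE; residual = {[SemiAnbd] Thm. 6.5 (ii) (F-1658), the normaliser witness `hfix`, `hμ` (`Π^tp_X`
acts trivially on `Δ_Θ / l·Δ_Θ`), the assembly's own binders}. [cite: MochizukiEtTh2009, Cor 2.9 p.43] -/
theorem exists_temperedCoverData_hasMuL_cor29_card_of_cuspLaws_of_normalizer_of_odd (e : M.CLevelData)
    (ιC : M.GtpC →ₜ* PC) (hιC : IsProfiniteCompletion ιC) (hinj : Function.Injective ιC)
    (op : M.toThetaSetting.OncePuncturedData) (hL : M.toThetaSetting.CuspLaws) {l : ℕ} (hodd : Odd l)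
    {x : M.Pt} (hx : M.IsCusp x)
    (hιell : ∀ c ∈ (e.piCDataOf ιC hιC).augGK.ker, c ∉ (e.piCDataOf ιC hιC).PiX →
      ∀ d ∈ (e.piCDataOf ιC hιC).PiX ⊓ (e.piCDataOf ιC hιC).augGK.ker,
        c * d * c⁻¹ * d ∈ (e.piCDataOf ιC hιC).barTheta l)
    (h02 : Thm16Sub.KerToZIsCompactlyGenerated M.toThetaSetting)
    (h65 : M.toTemperedCurve.DecompCommensurablyTerminal)
    (hfix : ∃ g : M.GtpC, g ∉ M.inclX.range ∧
      g ∈ Subgroup.normalizer (((M.decomp x).map M.inclX : Subgroup M.GtpC) : Set M.GtpC))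
    (hμ : ∀ (σ : M.PiTemp) (a : M.GtpTheta), a ∈ M.DeltaTheta →
      M.toTheta σ * a * (M.toTheta σ)⁻¹ * a⁻¹ ∈ M.lDeltaTheta l) :
    ∃ T : TemperedCoverData.{0} l,
      T.toCoverDataAx = (e.piCDataOf ιC hιC).coverDataAx l op hx hodd
        (e.piCDataOf_hIx_of_cuspLaws ιC hιC op hL hodd hx) hιell
        ((e.piCDataOf ιC hιC).inv_theta_of_inv_ell l op hιell) ∧ T.HasMuL ∧ T.Cor29_card := by
  obtain ⟨s, hs, hsa, hsc⟩ := hL.exists_section hx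
  exact ⟨e.temperedCoverData ιC hιC hinj op hodd hx (e.piCDataOf_hIx_of_cuspLaws ιC hιC op hL hodd hx) hιell
      (e.map_inclX_GtpXu_normal l h02) (e.map_inclX_GtpY_normal h02)
      ((e.piCDataOf ιC hιC).isSplitting_of_section l op hx hodd _ hιell _ s hs hsa)
      ((e.piCDataOf ιC hιC).isClosed_splittingOfSection l op s hsc),
    e.temperedCoverData_toCoverDataAx ιC hιC hinj op hodd hx _ hιell _ _ _ _,
    e.temperedCoverData_hasMuL ιC hιC hinj op hodd hx _ hιell _ _ _ _ hμ,
    temperedCoverData_cor29_card_of_odd e ιC hιC hinj op hodd hx _ hιell _ _ _ _ (op.isCompact_decomp x) h65 hfix⟩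

end MuTwoSetting.CLevelData

/-! ## §2. The census of record at the cusped untwisted Krull model `κ′` -/

namespace SettingModel

variable (p : ℕ) [Fact p.Prime]

/-- **[EtTh] Cor. 2.9 at `inversionModelκ′` OUTRIGHT — and Prop. 2.6 AS TYPED false at the SAME cover.** For odd `l` and the
bundle `eX`, THE cusp-law cover `T` of abc-iut-L2-t10's K8/K10 (abc-iut-L2-d3's assembly over `toHatCκ` with the section splitting)
satisfies the κ′ cover-data axioms, `T.HasMuL`, `T.Cor29_card` (NO «`T.Prop26 →`»), and `¬ T.Prop26` (abc-iut-f-151): K10's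
residual {Prop. 2.6 (F-0610)} was IDLE for Cor. 2.9 at `κ′`. [cite: MochizukiEtTh2009, Cor 2.9 p.43] -/
theorem exists_temperedCoverData_cor29_not_prop26_inversionModelκ' {l : ℕ} (hodd : Odd l)
    (eX : (ThetaSetting.modelκ' p).OncePuncturedData) :
    ∃ T : TemperedCoverData.{0} l,
      T.toCoverDataAx = ((cLevelDataInvκ' p).piCDataOf (toHatCκ p) (isProfiniteCompletion_toHatCκ p)).coverDataAx l eX
        (x := ()) trivial hodd (hIx_piCDataOf_toHatCκ p l hodd.pos eX ())
        (inv_ell_piCDataOf_toHatCκ p l eX) (inv_theta_piCDataOf_toHatCκ p l eX) ∧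
      T.HasMuL ∧ T.Cor29_card ∧ ¬ T.Prop26 := by
  obtain ⟨s, hs, hsa, hsc⟩ := (cuspLaws_modelκ' p).exists_section (x := ()) trivial
  exact ⟨_, (cLevelDataInvκ' p).temperedCoverData_toCoverDataAx (toHatCκ p) (isProfiniteCompletion_toHatCκ p)
      (toHatCκ_injective p) eX hodd trivial _ (inv_ell_piCDataOf_toHatCκ p l eX)
      ((cLevelDataInvκ' p).map_inclX_GtpXu_normal l (kerToZIsCompactlyGenerated_modelκ' p))
      ((cLevelDataInvκ' p).map_inclX_GtpY_normal (kerToZIsCompactlyGenerated_modelκ' p))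
      (((cLevelDataInvκ' p).piCDataOf (toHatCκ p) (isProfiniteCompletion_toHatCκ p)).isSplitting_of_section l eX
        (x := ()) trivial hodd _ (inv_ell_piCDataOf_toHatCκ p l eX) _ s hs hsa)
      (((cLevelDataInvκ' p).piCDataOf (toHatCκ p) (isProfiniteCompletion_toHatCκ p)).isClosed_splittingOfSection
        l eX s hsc),
    (cLevelDataInvκ' p).temperedCoverData_hasMuL (toHatCκ p) (isProfiniteCompletion_toHatCκ p)
      (toHatCκ_injective p) eX hodd (x := ()) trivial _ (inv_ell_piCDataOf_toHatCκ p l eX) _ _ _ _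
      (conj_commutator_mem_lDeltaTheta_inversionModelκ' p l),
    (cLevelDataInvκ' p).temperedCoverData_cor29_card_of_odd (toHatCκ p) (isProfiniteCompletion_toHatCκ p)
      (toHatCκ_injective p) eX hodd trivial _ (inv_ell_piCDataOf_toHatCκ p l eX) _ _ _ _
      (eX.isCompact_decomp ()) (decompCommensurablyTerminal_curveκ' p) (hfix_inversionModelκ' p),
    not_prop26_temperedCoverData_inversionModelκ' p eX hodd trivial _ _ _ _ _ _⟩

/-- **THE CENSUS OF RECORD at `κ′`, UNPACKED, with NO Prop. 2.6 anywhere** (cf. abc-iut-L2-t10's K10 v3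
`exists_temperedCoverData_rmk261_cor29_census_inversionModelκ'`, whose clauses (iv)/(v) read «`T.Prop26 → …`»). For odd `l ≠ 1`
and the bundle `eX`, THE cusp-law cover `T` satisfies: (i) the κ′ cover-data axioms; (ii) `HasMuL`; (iii) `¬ T.Prop26` (abc-iut-f-151);
(iv) Rmk. 2.6.1 undotted — `Aut_K(X̲̲) ≅ ℤ/l × ℤ/2`, `Aut_K(X̲) ≅ D_l`, `Aut_K(C̲̲) ≅ ℤ/l`, `Aut_K(C̲) = 1`; (v) **Rmk. 2.6.1 dotted
OUTRIGHT** — `Aut_K(Ẋ̲̲) ≅ (ℤ/l × ℤ/2) × ℤ/2`, `Aut_K(Ẋ̲) ≅ D_l × ℤ/2`, `Aut_K(Ċ̲̲) ≅ ℤ/l × ℤ/2`, `Aut_K(Ċ̲) ≅ ℤ/2`;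
(vi) **the six-member count OUTRIGHT** — each of `Ẋ̲̲, Ċ̲, Ċ̲̲, X̲̲, C̲, C̲̲` has `(l+1)/2` `Aut_K`-orbits of cusps. Print's SIX, not fewer.
[cite: MochizukiEtTh2009, Cor 2.9 p.43] -/
theorem exists_temperedCoverData_rmk261_cor29_census_inversionModelκ'_of_odd {l : ℕ} [NeZero l] (hodd : Odd l)
    (eX : (ThetaSetting.modelκ' p).OncePuncturedData) :
    ∃ T : TemperedCoverData.{0} l,
      T.toCoverDataAx = ((cLevelDataInvκ' p).piCDataOf (toHatCκ p) (isProfiniteCompletion_toHatCκ p)).coverDataAx l eX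
        (x := ()) trivial hodd (hIx_piCDataOf_toHatCκ p l hodd.pos eX ())
        (inv_ell_piCDataOf_toHatCκ p l eX) (inv_theta_piCDataOf_toHatCκ p l eX) ∧
      T.HasMuL ∧ ¬ T.Prop26 ∧
      (Nonempty (T.autK (T.tp T.PiXuu) ≃* Multiplicative (ZMod l) × Multiplicative (ZMod 2)) ∧
        Nonempty (T.autK (T.tp T.PiXu) ≃* DihedralGroup l) ∧
        Nonempty (T.autK (T.tp T.PiCuu) ≃* Multiplicative (ZMod l)) ∧
        Subsingleton (T.autK (T.tp T.PiCu))) ∧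
      (Nonempty (T.autK (T.tp T.PiXuu ⊓ T.PiCdot) ≃*
          (Multiplicative (ZMod l) × Multiplicative (ZMod 2)) × Multiplicative (ZMod 2)) ∧
        Nonempty (T.autK (T.tp T.PiXu ⊓ T.PiCdot) ≃* DihedralGroup l × Multiplicative (ZMod 2)) ∧
        Nonempty (T.autK (T.tp T.PiCuu ⊓ T.PiCdot) ≃* Multiplicative (ZMod l) × Multiplicative (ZMod 2)) ∧
        Nonempty (T.autK (T.tp T.PiCu ⊓ T.PiCdot) ≃* Multiplicative (ZMod 2))) ∧
      (∀ S' ∈ [T.tp T.PiXuu ⊓ T.PiCdot, T.tp T.PiCu ⊓ T.PiCdot, T.tp T.PiCuu ⊓ T.PiCdot,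
          T.tp T.PiXuu, T.tp T.PiCu, T.tp T.PiCuu], Nat.card (T.cuspOrbits S') = (l + 1) / 2) := by
  obtain ⟨s, hs, hsa, hsc⟩ := (cuspLaws_modelκ' p).exists_section (x := ()) trivial
  have hMuL := (cLevelDataInvκ' p).temperedCoverData_hasMuL (toHatCκ p) (isProfiniteCompletion_toHatCκ p)
      (toHatCκ_injective p) eX hodd (x := ()) trivial (hIx_piCDataOf_toHatCκ p l hodd.pos eX ())
      (inv_ell_piCDataOf_toHatCκ p l eX)
      ((cLevelDataInvκ' p).map_inclX_GtpXu_normal l (kerToZIsCompactlyGenerated_modelκ' p))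
      ((cLevelDataInvκ' p).map_inclX_GtpY_normal (kerToZIsCompactlyGenerated_modelκ' p))
      (((cLevelDataInvκ' p).piCDataOf (toHatCκ p) (isProfiniteCompletion_toHatCκ p)).isSplitting_of_section l eX
        (x := ()) trivial hodd _ (inv_ell_piCDataOf_toHatCκ p l eX) _ s hs hsa)
      (((cLevelDataInvκ' p).piCDataOf (toHatCκ p) (isProfiniteCompletion_toHatCκ p)).isClosed_splittingOfSection l eX s hsc)
      (conj_commutator_mem_lDeltaTheta_inversionModelκ' p l)
  refine ⟨_, (cLevelDataInvκ' p).temperedCoverData_toCoverDataAx (toHatCκ p) (isProfiniteCompletion_toHatCκ p)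
      (toHatCκ_injective p) eX hodd trivial _ (inv_ell_piCDataOf_toHatCκ p l eX) _ _ _ _, hMuL,
    not_prop26_temperedCoverData_inversionModelκ' p eX hodd trivial _ _ _ _ _ _, ?_, ?_, ?_⟩
  · exact (cLevelDataInvκ' p).rmk261_ofSetting (toHatCκ p) (isProfiniteCompletion_toHatCκ p) (toHatCκ_injective p) eX
      hodd trivial _ (inv_ell_piCDataOf_toHatCκ p l eX) _ _ _ _ hMuL
  · exact (cLevelDataInvκ' p).temperedCoverData_rmk261_dotted_of_odd (toHatCκ p) (isProfiniteCompletion_toHatCκ p)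
      (toHatCκ_injective p) eX hodd trivial _ (inv_ell_piCDataOf_toHatCκ p l eX) _ _ _ _ hMuL
  · exact (cLevelDataInvκ' p).temperedCoverData_cor29_card_of_odd (toHatCκ p) (isProfiniteCompletion_toHatCκ p)
      (toHatCκ_injective p) eX hodd trivial _ (inv_ell_piCDataOf_toHatCκ p l eX) _ _ _ _
      (eX.isCompact_decomp ()) (decompCommensurablyTerminal_curveκ' p) (hfix_inversionModelκ' p) hMuL

/-- **The row's one-line verdict** («COR29-SIX-COUNT@κ′ WITHOUT PROP26»): at `κ′` there is a cover datum with `¬ Prop26` (as typed) whose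
SIX members `Ẋ̲̲, Ċ̲, Ċ̲̲, X̲̲, C̲, C̲̲` each have exactly `(l+1)/2` `Aut_K`-orbits of cusps — print's count, derived WITHOUT Prop. 2.6.
[cite: MochizukiEtTh2009, Cor 2.9 p.43] -/
theorem exists_temperedCoverData_not_prop26_and_six_count_inversionModelκ' {l : ℕ} [NeZero l] (hodd : Odd l)
    (eX : (ThetaSetting.modelκ' p).OncePuncturedData) :
    ∃ T : TemperedCoverData.{0} l, ¬ T.Prop26 ∧
      ∀ S' ∈ [T.tp T.PiXuu ⊓ T.PiCdot, T.tp T.PiCu ⊓ T.PiCdot, T.tp T.PiCuu ⊓ T.PiCdot,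
          T.tp T.PiXuu, T.tp T.PiCu, T.tp T.PiCuu], Nat.card (T.cuspOrbits S') = (l + 1) / 2 := by
  obtain ⟨T, -, -, h26, -, -, hsix⟩ := exists_temperedCoverData_rmk261_cor29_census_inversionModelκ'_of_odd p hodd eX
  exact ⟨T, h26, hsix⟩

end SettingModel

end Literature.AnabelianGeometry.EtaleTheta

end
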